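import Literature.MathematicalPhysics.QuantumFieldTheory.BalabanImbrieJaffe1984to88.BIJ88Sect4Statements
import Literature.MathematicalPhysics.QuantumFieldTheory.Balaban1983to89.Beta.GaussianIntegral

/-!
# `BalabanImbrieJaffe1984to88.BIJ88Normalization46` — T. Bałaban, J. Imbrie, A. Jaffe, *Effective action and cluster
properties of the abelian Higgs model*, Commun. Math. Phys. **114** (1988) 257–315 [BalabanImbrieJaffe1988]: the two
Gaussian normalization factors of the inductive representation, (4.6) (gauge field, with axial-gauge and block-average
δ-functions) and (4.9) (scalar field), p. 275, TYPED in finite dimension with their closed forms PROVED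

statement-level skeleton of published theorems with citation tags; proofs where landed; nothing here is a claim about the Yang–Mills mass gap

PDF held: `paper:balaban1988-cmp114-bij-abelian-higgs-effective-action` (journal page = PDF page + 256).  Render read as an
image (poppler ×3): PDF p. 19 (journal 275).

CITATION HEADER (lean-in-tree rule).  Part of the lit-balaban TYPED SKELETON (HOME `run/shared/lean/pub/lit-balaban/`; rows
`C2.Eq4.6` and `C2.Eq4.9` of `HOME/lit-balaban-r18/ROWS-C2.md`; unit `lit-balaban-r18`, gen 2).  WHAT IS REPRODUCED, verbatim,
p. 275 [PDF 19]: *"The Gaussian normalization factors are given now, in a rescaled form.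
Z^{(j)}_{Λ₁₀^{(j)c*c}} = ∫ 𝒟A_{Λ₁₀^{(j)c*c}} δ_{Ax, Λ₁₀^{(j)′}}(A) δ_{Λ₁₀^{(j)′c*c}}(QΛ₁₀^{(j)c*c}A)
  × exp(−½⟨Λ₁₀^{(j)c*c}A, ∂*σ^{L^jη}_{j,loc}∂Λ₁₀^{(j)c*c}A⟩ − E^{(j)}_{k,v}‖Λ₁₀^{(j)c*c}‖), (4.6)
where A lies on the L^jη-lattice. The subscript to 𝒟A indicates where an A-field is integrated; the subscripts to δ_{Ax} and
δ(QA) indicate which blocks have axial gauge conditions and which block bonds have conditions on QA. We have Dirichlet boundary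
conditions in Λ₁₀^{(j)c*}. We have included a constant factor to take care of the scalings and make this independent of k. It is
defined using E^{(j)}_{k,v} = −log[(e_j/2π)(L^jη)^{(d−2)/2}], (4.7) ‖Λ₁₀^{(j)c*c}‖ = |Λ₁₀^{(j)c*c}| − |Λ₁₀^{(j)′}|(L^d − 1) −
|Λ₁₀^{(j)′c*c}|. (4.8) Here ‖Λ₁₀^{(j)c*c}‖ is the number of free integrations in Λ₁₀^{(j)c*c} after enforcing the δ-functions.
Similarly for the scalar field we have Z^{(j)}_{Λ₁₀^{(j)}}(u_k) = ∫ 𝒟φ_{Λ₁₀^{(j)}} exp(−½⟨Λ₁₀^{(j)}φ, (Δ^{L^jη}_{j,loc}(u_k) +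
aL^{−2}P(u_k))Λ₁₀^{(j)}φ⟩ − E^{(j)}_{k,s}|Λ₁₀^{(j)}|), (4.9) with P(u_k) = Q(u_k)*Q(u_k), (4.10) E^{(j)}_{k,s} = −(d−2) log L^jη.
(4.11)"*.
TYPED READING (finite-dimensional model of the tree's `Balaban1983to89.Beta.GaussianIntegral` / `Beta.OneLoop`, the same
model as `B14GaussianDet333` and `B12` (1.4)).  (4.6): the `n = |Λ₁₀^{c*c}|` real bond variables `A` are `Fin n → ℝ`; the two
families of δ-functions are LINEAR constraints on `A` (axial gauge on the blocks of `Λ₁₀′`: `A_b = 0` on the `|Λ₁₀′|(L^d − 1)` tree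
bonds; block averages: `(QΛ₁₀^{c*c}A)_c = 0` on the `|Λ₁₀′^{c*c}|` block bonds), stacked into ONE `m × n` matrix `K`, and
`δ_{Ax}δ(Q·)` is the product of `m` one-dimensional Dirac δ's of `KA` — the convention of [Balaban1984PropagatorsI] (1.11)
realised in `Beta.GaussianIntegral` as the `ε ↓ 0` limit of heat-kernel regularisations (`ConstrainedGaussian.regZ`); the
precision `S = Λ₁₀^{c*c}∂*σ^{L^jη}_{j,loc}∂Λ₁₀^{c*c}` (Dirichlet b.c. = restriction to `Λ₁₀^{c*c}`) is an `n × n` real matrix.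
So (4.6) is `Z46 Z E N := e^{−E·N} · lim_{ε↓0} regZ Z ε` for `Z = ⟨K, S⟩ : ConstrainedGaussian n m`, `E = E^{(j)}_{k,v}`
(`BIJ88Sect4Statements.Ekv`), `N = ‖Λ₁₀^{c*c}‖` (`BIJ88Sect4Statements.freeCount`).  (4.9): the complex scalar field on the
`|Λ₁₀|` sites in real coordinates `ι` (`|ι| = 2|Λ₁₀|`), the form `Δ_{j,loc}(u_k) + aL^{−2}P(u_k)` restricted to `Λ₁₀` as a real
symmetric matrix `T` on `ι`; `Z49 T E N := e^{−E·N} ∫ exp(−½ vᵀTv) dv`, `E = E^{(j)}_{k,s}` (`BIJ88Sect4Statements.Eks`),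
`N = |Λ₁₀|`.
PROVED (kernel-checked, 0 sorry): under the tree's `ConstrainedGaussian.Regular` (constraints onto, `S` symmetric and positive
on `ker K ∖ {0}`) the limit defining (4.6) exists and `Z46 = e^{−E‖Λ‖}(2π)^{(n−m)/2}|det[[S,Kᵀ],[K,0]]|^{−1/2}` (`Z46_eq`,
`log_Z46`), and the printed sentence *"‖Λ‖ is the number of free integrations after enforcing the δ-functions"* is the exponent
bookkeeping `n − m = ‖Λ‖` (`freeCount_eq_sub`, `log_Z46_freeCount`); for `T` positive definite
`Z49 = e^{−E|Λ₁₀|}(2π)^{|ι|/2}(det T)^{−1/2}` (`Z49_eq`, `log_Z49`, `Z49_pos`), with (4.11) substituted (`log_Z49_sites`).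
NOT HERE: the operators `σ_{j,loc}`, `Δ_{j,loc}(u_k)`, `Q(u_k)` themselves (rows C2.Eq2.14/2.34/4.10, typed in
`BIJ88Sect2Statements`/`BIJ88Sect4Statements` over abstract carriers), their positivity (hypotheses `hZ`, `hT` here; the paper's
(2.19), (2.38)), and the claim that the constants make `Z` "independent of k".
-/

namespace Literature.MathematicalPhysics.QuantumFieldTheory.BalabanImbrieJaffe1984to88.BIJ88Normalization46

open _root_.MeasureTheory _root_.Filter Matrix
open scoped _root_.Topology Real
open Literature.MathematicalPhysics.QuantumFieldTheory.Balaban1983to89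
open Literature.MathematicalPhysics.QuantumFieldTheory.Balaban1983to89.Beta

noncomputable section

/-! ## (4.6) the gauge-field normalization factor with δ-functions -/

section GaugeField

variable {n m : ℕ}

/-- **(4.6)** p. 275 [PDF 19], verbatim: *"Z^{(j)}_{Λ₁₀^{(j)c*c}} = ∫ 𝒟A_{Λ₁₀^{(j)c*c}} δ_{Ax,Λ₁₀^{(j)′}}(A) δ_{Λ₁₀^{(j)′c*c}}(QΛ₁₀^{(j)c*c}A)
exp(−½⟨Λ₁₀^{(j)c*c}A, ∂*σ^{L^jη}_{j,loc}∂Λ₁₀^{(j)c*c}A⟩ − E^{(j)}_{k,v}‖Λ₁₀^{(j)c*c}‖), (4.6)"* — typed reading: `Z.Q = K` the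
stacked `m × n` matrix of the axial-gauge and block-average constraints, `Z.Δ = S` the precision `Λ∂*σ_{j,loc}∂Λ` on the `n`
integrated bond variables, the δ-functions in the product convention of [Balaban1984PropagatorsI] (1.11) as the `ε ↓ 0` limit
of `ConstrainedGaussian.regZ`; `E = E^{(j)}_{k,v}` of (4.7), `N = ‖Λ₁₀^{(j)c*c}‖` of (4.8).
[cite: BalabanImbrieJaffe1988, (4.6) p.275] -/
def Z46 (Z : ConstrainedGaussian n m) (E N : ℝ) : ℝ :=
  Real.exp (-(E * N)) * limUnder (𝓝[>] (0 : ℝ)) (ConstrainedGaussian.regZ Z)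

/-- The δ-constrained Gaussian integral in (4.6) exists as the `ε ↓ 0` limit of its regularisations and equals `exp` of the
tree's closed form `ConstrainedGaussian.logZ` (under `Regular`: constraints onto, precision symmetric and positive on the
constraint kernel). [cite: BalabanImbrieJaffe1988, (4.6) p.275] -/
theorem limUnder_regZ_eq (Z : ConstrainedGaussian n m) (hZ : Z.Regular) :
    limUnder (𝓝[>] (0 : ℝ)) (ConstrainedGaussian.regZ Z) = Real.exp Z.logZ :=
  (ConstrainedGaussian.tendsto_regZ Z hZ).limUnder_eq

/-- **(4.6) evaluated**: `Z^{(j)} = e^{−E‖Λ‖} · (2π)^{(n−m)/2} · |det[[S, Kᵀ],[K, 0]]|^{−1/2}` (`n` integrated bond variables,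
`m` δ-function constraints). [cite: BalabanImbrieJaffe1988, (4.6) p.275] -/
theorem Z46_eq (Z : ConstrainedGaussian n m) (hZ : Z.Regular) (E N : ℝ) :
    Z46 Z E N = Real.exp (-(E * N)) * ((2 * π) ^ (((n : ℝ) - m) / 2) * |Z.kkt.det| ^ (-(1 / 2 : ℝ))) := by
  rw [Z46, limUnder_regZ_eq Z hZ, ConstrainedGaussian.exp_logZ Z hZ]

/-- (4.6) is a positive number (under `Regular`). [cite: BalabanImbrieJaffe1988, (4.6) p.275] -/
theorem Z46_pos (Z : ConstrainedGaussian n m) (hZ : Z.Regular) (E N : ℝ) : 0 < Z46 Z E N := by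
  rw [Z46, limUnder_regZ_eq Z hZ]
  exact mul_pos (Real.exp_pos _) (Real.exp_pos _)

/-- **(4.6) in logarithmic form**: `log Z^{(j)} = −E‖Λ‖ + ((n − m)/2)·log 2π − ½·log|det[[S, Kᵀ],[K, 0]]|`.
[cite: BalabanImbrieJaffe1988, (4.6) p.275] -/
theorem log_Z46 (Z : ConstrainedGaussian n m) (hZ : Z.Regular) (E N : ℝ) :
    Real.log (Z46 Z E N) = -(E * N) + ((n : ℝ) - m) / 2 * Real.log (2 * π) - (1 / 2 : ℝ) * Real.log |Z.kkt.det| := by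
  rw [Z46, limUnder_regZ_eq Z hZ, Real.log_mul (Real.exp_pos _).ne' (Real.exp_pos _).ne', Real.log_exp, Real.log_exp,
    ConstrainedGaussian.logZ]
  ring

/-- **(4.8)** read as printed, *"‖Λ₁₀^{(j)c*c}‖ is the number of free integrations in Λ₁₀^{(j)c*c} after enforcing the
δ-functions"*: with `n = |Λ₁₀^{c*c}|` integrated bond variables and `m = |Λ₁₀′|(L^d − 1) + |Λ₁₀′^{c*c}|` δ-functions (axial tree
bonds of the blocks + constrained block bonds), `n − m = BIJ88Sect4Statements.freeCount`. [cite: BalabanImbrieJaffe1988, (4.8) p.275] -/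
theorem freeCount_eq_sub (nB nSites' nB' L d : ℕ) {n m : ℕ} (hn : n = nB) (hm : m = nSites' * (L ^ d - 1) + nB') (hL : 1 ≤ L) :
    (BIJ88Sect4Statements.freeCount nB nSites' nB' L d : ℝ) = (n : ℝ) - m := by
  subst hn hm
  have hLd : 1 ≤ L ^ d := Nat.one_le_pow _ _ hL
  simp only [BIJ88Sect4Statements.freeCount]
  push_cast [hLd]
  ring

/-- (4.6) with the exponent bookkeeping of (4.8): when `n − m = ‖Λ‖ = N`,
`log Z^{(j)} = ‖Λ‖·(½ log 2π − E^{(j)}_{k,v}) − ½·log|det[[S, Kᵀ],[K, 0]]|` — the printed constant `E^{(j)}_{k,v}‖Λ‖` is one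
unit of `E` per free integration. [cite: BalabanImbrieJaffe1988, (4.6) p.275] -/
theorem log_Z46_freeCount (Z : ConstrainedGaussian n m) (hZ : Z.Regular) (E N : ℝ) (hN : (n : ℝ) - m = N) :
    Real.log (Z46 Z E N) = N * (Real.log (2 * π) / 2 - E) - (1 / 2 : ℝ) * Real.log |Z.kkt.det| := by
  rw [log_Z46 Z hZ, hN]
  ring

/-- (4.6) with its printed constant (4.7) `E^{(j)}_{k,v} = −log[(e_j/2π)(L^jη)^{(d−2)/2}]` substituted: for `e_j > 0`, `L^jη > 0`,
`log Z^{(j)} = ‖Λ‖·(½ log 2π + log(e_j/2π) + ((d−2)/2) log L^jη) − ½·log|det K|`. [cite: BalabanImbrieJaffe1988, (4.7) p.275] -/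
theorem log_Z46_Ekv (Z : ConstrainedGaussian n m) (hZ : Z.Regular) {ej Ljη : ℝ} (hej : 0 < ej) (hL : 0 < Ljη) (d : ℕ)
    (N : ℝ) (hN : (n : ℝ) - m = N) :
    Real.log (Z46 Z (BIJ88Sect4Statements.Ekv ej Ljη d) N) =
      N * (Real.log (2 * π) / 2 + Real.log (ej / (2 * π)) + ((d : ℝ) - 2) / 2 * Real.log Ljη)
        - (1 / 2 : ℝ) * Real.log |Z.kkt.det| := by
  rw [log_Z46_freeCount Z hZ _ N hN, BIJ88Sect4Statements.Ekv,
    Real.log_mul (div_pos hej (by positivity)).ne' (Real.rpow_pos_of_pos hL _).ne', Real.log_rpow hL]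
  ring

end GaugeField

/-! ## (4.9) the scalar-field normalization factor -/

section ScalarField

variable {ι : Type*} [Fintype ι] [DecidableEq ι]

/-- **(4.9)** p. 275 [PDF 19], verbatim: *"Similarly for the scalar field we have Z^{(j)}_{Λ₁₀^{(j)}}(u_k) = ∫ 𝒟φ_{Λ₁₀^{(j)}}
exp(−½⟨Λ₁₀^{(j)}φ, (Δ^{L^jη}_{j,loc}(u_k) + aL^{−2}P(u_k))Λ₁₀^{(j)}φ⟩ − E^{(j)}_{k,s}|Λ₁₀^{(j)}|), (4.9)"* — typed reading: `ι` the
real coordinates of the complex scalar field on the sites of `Λ₁₀^{(j)}` (`|ι| = 2|Λ₁₀|`), `T` the real symmetric matrix of the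
form `Δ^{L^jη}_{j,loc}(u_k) + aL^{−2}P(u_k)` restricted to `Λ₁₀` (`P(u_k) = Q(u_k)*Q(u_k)`, (4.10)), `𝒟φ` = Lebesgue measure,
`E = E^{(j)}_{k,s}` of (4.11), `N = |Λ₁₀^{(j)}|`. [cite: BalabanImbrieJaffe1988, (4.9) p.275] -/
def Z49 (T : Matrix ι ι ℝ) (E N : ℝ) : ℝ :=
  Real.exp (-(E * N)) * ∫ v : ι → ℝ, Real.exp (-(1 / 2 : ℝ) * (v ⬝ᵥ T *ᵥ v))

/-- **(4.9) evaluated**: for `T` positive definite, `Z^{(j)}(u_k) = e^{−E|Λ₁₀|} · √(2π)^{|ι|} / √(det T)` (from the tree's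
`Beta.GaussianIntegral.integral_exp_neg_half_quadForm`). [cite: BalabanImbrieJaffe1988, (4.9) p.275] -/
theorem Z49_eq (T : Matrix ι ι ℝ) (hT : T.PosDef) (E N : ℝ) :
    Z49 T E N = Real.exp (-(E * N)) * (Real.sqrt (2 * π) ^ Fintype.card ι / Real.sqrt T.det) := by
  rw [Z49, GaussianIntegral.integral_exp_neg_half_quadForm T hT]

/-- (4.9) is a positive number (for `T` positive definite). [cite: BalabanImbrieJaffe1988, (4.9) p.275] -/
theorem Z49_pos (T : Matrix ι ι ℝ) (hT : T.PosDef) (E N : ℝ) : 0 < Z49 T E N := by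
  rw [Z49_eq T hT]
  exact mul_pos (Real.exp_pos _) (div_pos (pow_pos (Real.sqrt_pos.2 (by positivity)) _) (Real.sqrt_pos.2 hT.det_pos))

/-- **(4.9) in logarithmic form**: `log Z^{(j)}(u_k) = −E|Λ₁₀| + (|ι|/2)·log 2π − ½·log det T`.
[cite: BalabanImbrieJaffe1988, (4.9) p.275] -/
theorem log_Z49 (T : Matrix ι ι ℝ) (hT : T.PosDef) (E N : ℝ) :
    Real.log (Z49 T E N) = -(E * N) + (Fintype.card ι : ℝ) / 2 * Real.log (2 * π) - (1 / 2 : ℝ) * Real.log T.det := by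
  have hI : 0 < ∫ v : ι → ℝ, Real.exp (-(1 / 2 : ℝ) * (v ⬝ᵥ T *ᵥ v)) := by
    rw [GaussianIntegral.integral_exp_neg_half_quadForm T hT]
    exact div_pos (pow_pos (Real.sqrt_pos.2 (by positivity)) _) (Real.sqrt_pos.2 hT.det_pos)
  rw [Z49, Real.log_mul (Real.exp_pos _).ne' hI.ne', Real.log_exp, GaussianIntegral.log_integral_exp_neg_half_quadForm T hT]
  ring

/-- (4.9) with (4.11) `E^{(j)}_{k,s} = −(d−2) log L^jη` substituted and two real coordinates per site (`|ι| = 2|Λ₁₀|`):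
`log Z^{(j)}(u_k) = |Λ₁₀|·((d−2) log L^jη + log 2π) − ½·log det T`. [cite: BalabanImbrieJaffe1988, (4.11) p.275] -/
theorem log_Z49_sites (T : Matrix ι ι ℝ) (hT : T.PosDef) (d nΛ : ℕ) (Ljη : ℝ) (hι : Fintype.card ι = 2 * nΛ) :
    Real.log (Z49 T (BIJ88Sect4Statements.Eks d Ljη) nΛ) =
      (nΛ : ℝ) * (((d : ℝ) - 2) * Real.log Ljη + Real.log (2 * π)) - (1 / 2 : ℝ) * Real.log T.det := by
  rw [log_Z49 T hT, hι, BIJ88Sect4Statements.Eks]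
  push_cast
  ring

end ScalarField

end

end Literature.MathematicalPhysics.QuantumFieldTheory.BalabanImbrieJaffe1984to88.BIJ88Normalization46
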